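import Summits.BirchSwinnertonDyer.BirchSwinnertonDyer.Theorems.ManinLocalTwoThreeManinThreeKummerCubeArith
import Summits.BirchSwinnertonDyer.BirchSwinnertonDyer.Theorems.ManinLocalTwoThreeKummerTriplingSeries
import Summits.BirchSwinnertonDyer.BirchSwinnertonDyer.Theorems.ManinLocalTwoThreeManinPrimeToThreeOfEtaExponentOfCube
import HarnessLib

/-!
# E-an-55 `ManinThreeKummerCube` PROVED: a Manin constant divisible by `3` cubes the tangent-line Kummer class

Summit `BirchSwinnertonDyer`, route `ManinLocalTwoThree` (cell bsd-f2-manin), crux C3 `ManinPrimeToThreeAtNine`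
(stmt-BirchSwinnertonDyer-22968), reducible residual `Rb₃` of the line `kato_shift_three`.  The an planner's
`p = 3` cuspidal Kummer certificate (MEMO-an §56.7/§56.12, typed leaf `…ManinAdditive.CuspidalKummerClass`, namespace
`CuspidalKummerThree`) reads: E-an-58 = E-an-55 + E-an-56 + UFD step; E-an-56 (`etaUnitCubeIffThree_holds`, p3 g4)
and the UFD step (`maninPrimeToThreeOfEtaExponent_of_maninThreeKummerCube`, p2 g6) are tree theorems.  Here the
remaining row E-an-55 (REF1 §R50: «theorem-grade modulo Honda (III)») is proved BY NAME and UNCONDITIONALLY: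

  `ManinThreeKummerCube_holds : ManinThreeKummerCube`

— for globally minimal elliptic `W`, a modular parametrisation datum `D` at a level `N` with `9 ∣ N`, integral
newform coefficients `aₙ`, a rational point `(X₀, Y₀)` of order `3` of the short model `E_{W,c}` (`c = D.c`) and
the formal germ `z` (`log_{E_{W,c}}(z) = Σ aₙqⁿ/n`): `3 ∣ c ⇒` the tangent-line Kummer series
`Θ_T = z³·(y(z) − Y₀ − α(x(z) − X₀))` is a cube in `Frac ℤ₃⟦q⟧`.

PROOF.  (`…ManinThreeKummerCubeArith`) `9 ∣ N` gives `a₃(f) = 0`, `3 ∣ N_W`, so `aₙ(W) = 0` for `3 ∣ n` and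
`W` is ADDITIVE at `3`; then `3 ∣ c₄ ⇒ 27 ∣ c₆`, so `E♮ = E_{W,1} : y² = x³ − (c₄/48)x − c₆/864` is `3`-INTEGRAL
with CUSPIDAL reduction, whence — Honda's remark that infinite height means type `p`, the tree's
`CuspidalReductionInfiniteHeightProofs` — `log_{E♮}, exp_{E♮} ∈ ℤ₃⟦T⟧`: «Honda (III)» at the additive prime
`3` is a tree theorem.  `E_{W,c} = (c⁻¹, 0, 0, 0) • E♮` turns the germ into `log_{E♮}(c z) = c L`,
`L = Σ aₙqⁿ/n ∈ ℤ₃⟦q⟧`; with `c = 3c′`, `t := exp_{E♮}(c′L) ∈ qℤ₃⟦q⟧` and `c z = [3](t)`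
(`eq_formalMul_subst_formalExp_of_formalLog_subst'`).  The `3`-torsion point becomes `T♮ = (X₀/c², Y₀/c³)` on
`E♮`, with tangent slope `α/c`, and `Θ_T` read on `E♮ ⊗ ℚ₃` is exactly the series of
`kummerTripling_padic` (`…KummerTriplingSeries`: the Kummer identity `ω₃ = G³` on the Kubert form, transported
along the scaled change `(3^{-m}, X₁, λ, Y₁)` and the Laurent-point dictionary), which supplies
`A, B ∈ ℤ₃⟦q⟧`, `B ≠ 0`, `Θ_T·B³ = A³`.

HONEST FRAMING: this is the SUPPORT row E-an-55; with it the certificate E-an-58 `ManinPrimeToThreeOfEtaExponent`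
becomes unconditional (corollary below), but its `c`-free inputs — the crux K_geo (E-an-57: cuspidality of
`ι(T)`) and an exponent not divisible by `3` — stay open; nothing about BSD, about Manin's conjecture, or about
the `3`-divisibility of any actual Manin constant is proved here.
-/

set_option autoImplicit false
set_option linter.dupNamespace false

noncomputable section

open scoped Classical MatrixGroups ModularForm
open PowerSeries CongruenceSubgroup IsDedekindDomain NumberField Rat.HeightOneSpectrum
open WeierstrassCurve Literature.NumberTheory.EllipticCurves Literature.NumberTheory.EllipticCurves.ModularForms
  Literature.RingTheory.FormalGroups
open Summit.BirchSwinnertonDyer.Rank1Residual.ManinAdditive.CuspidalKummer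
  Summit.BirchSwinnertonDyer.Rank1Residual.ManinAdditive.CuspidalKummerThree

namespace Summit.BirchSwinnertonDyer.BirchSwinnertonDyer.Theorems.ManinLocalTwoThree

/-- **Theorem E-an-55 (`ManinThreeKummerCube`, cell bsd-f2-manin, MEMO-an §56.7; row of
`…ManinAdditive.CuspidalKummerClass`), PROVED: a Manin constant divisible by `3` cubes the tangent-line Kummer
class of a rational `3`-torsion point.**  Proof in the module docstring.  `IsParamGerm` and `IsShortThreeTorsion`
are inputs; nothing about BSD, Manin's conjecture or any actual Manin constant is asserted.
[cite: SilvermanAEC2009, IV.5.5 and Exercise 3.7(d) (shape: `log/exp`, division values; the `q`-expansion cube statement is the cell's, MEMO-an §56.7)]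
[cite: Honda1970, Thm. 2 (p. 223) (type `p` at infinite height)] -/
theorem ManinThreeKummerCube_holds : ManinThreeKummerCube := by
  intro W hWell hWmin N hN D a ha h9 X₀ Y₀ hT z hz h3c
  obtain ⟨hz0, hlog⟩ := hz
  obtain ⟨hns, hΨ⟩ := hT
  have hc0 : D.c ≠ 0 := D.maninConstant_ne_zero_holds
  obtain ⟨c', hc'⟩ := h3c
  -- §A arithmetic at `3`; the `3`-integral model `E♮`
  obtain ⟨ha3, hN3⟩ := lFunction_three_eq_zero_of_nine_dvd W D.isNewformOf h9
  obtain ⟨hΔ3, hc₄3⟩ := three_dvd_Δ_and_c₄_of_hasAdditiveReductionAt W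
    (hasAdditiveReductionAt_three_of_lFunction_three_eq_zero W ha3 hN3)
  obtain ⟨V, hV₁, hV₂, hV₃, hVE, hEll, -, hexpint⟩ := exists_padicInt_shortModel_three W hΔ3 hc₄3
  haveI := hEll
  haveI hInt : (V.map PadicInt.Coe.ringHom).IsIntegral ℤ_[3] := V.isIntegral_map_coe
  have han : ∀ n, a n = W.LFunction n := fun n => by
    have h := ha n; rw [D.isNewformOf.2 n] at h; exact_mod_cast h
  have hrat : ∀ q : ℚ, algebraMap ℚ ℚ_[3] q = (q : ℚ_[3]) := fun q => by rw [eq_ratCast]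
  have hEa₁ : (V.map PadicInt.Coe.ringHom).a₁ = 0 := by rw [map_a₁, hV₁, map_zero]
  have hEa₂ : (V.map PadicInt.Coe.ringHom).a₂ = 0 := by rw [map_a₂, hV₂, map_zero]
  have hEa₃ : (V.map PadicInt.Coe.ringHom).a₃ = 0 := by rw [map_a₃, hV₃, map_zero]
  have hEa₄ : (V.map PadicInt.Coe.ringHom).a₄ = ((shortModel W 1).a₄ : ℚ_[3]) := by rw [hVE, map_a₄, hrat]
  have hEa₆ : (V.map PadicInt.Coe.ringHom).a₆ = ((shortModel W 1).a₆ : ℚ_[3]) := by rw [hVE, map_a₆, hrat]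
  -- §B the germ read on `E♮ ⊗ ℚ₃`
  set ι : ℚ⟦X⟧ →+* ℚ_[3]⟦X⟧ := PowerSeries.map (algebraMap ℚ ℚ_[3]) with hι
  set z₃ : ℚ_[3]⟦X⟧ := ι z with hz₃
  set L₃ : ℚ_[3]⟦X⟧ := ι (lSeriesLog a) with hL₃
  set D₃ : ℚ_[3]⟦X⟧ := C ((D.c : ℚ) : ℚ_[3]) * z₃ with hD₃
  have hcz0 : constantCoeff (C (D.c : ℚ) * z) = 0 := by rw [map_mul, hz0, mul_zero]
  have hlog1 : (shortModel W 1).formalLog.subst (C (D.c : ℚ) * z) = C (D.c : ℚ) * lSeriesLog a := by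
    have h := formalLog_shortModel_subst W hc0 hz0
    rw [hlog] at h
    have hcc : (C (D.c : ℚ) : ℚ⟦X⟧) * C (D.c : ℚ)⁻¹ = 1 := by
      rw [← map_mul, mul_inv_cancel₀ (Int.cast_ne_zero.mpr hc0), map_one]
    calc (shortModel W 1).formalLog.subst (C (D.c : ℚ) * z)
        = C (D.c : ℚ) * C (D.c : ℚ)⁻¹ * (shortModel W 1).formalLog.subst (C (D.c : ℚ) * z) := by
          rw [hcc, one_mul]
      _ = C (D.c : ℚ) * lSeriesLog a := by rw [mul_assoc, ← h]
  have hz₃0 : constantCoeff z₃ = 0 := by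
    rw [hz₃, hι, ← coeff_zero_eq_constantCoeff, coeff_map, coeff_zero_eq_constantCoeff, hz0, map_zero]
  have hD₃0 : constantCoeff D₃ = 0 := by rw [hD₃, map_mul, hz₃0, mul_zero]
  have hL₃0 : constantCoeff L₃ = 0 := by
    rw [hL₃, hι, ← coeff_zero_eq_constantCoeff, coeff_map, lSeriesLog, coeff_mk]; simp
  have hlog2 : (V.map PadicInt.Coe.ringHom).formalLog.subst D₃ = C ((D.c : ℚ) : ℚ_[3]) * L₃ := by
    have h := congrArg ι hlog1
    rw [hι, map_subst_apply (HasSubst.of_constantCoeff_zero' hcz0), map_formalLog, ← hVE, map_mul,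
      map_C, map_mul, map_C, hrat] at h
    exact h
  -- §C dividing by `3`: `D₃ = [3](t)`, `t = exp_{E♮}(c′L)` integral
  have hcc' : ((D.c : ℚ) : ℚ_[3]) = (3 : ℕ) * ((c' : ℚ) : ℚ_[3]) := by
    rw [hc']; push_cast; ring
  set t : ℚ_[3]⟦X⟧ := (V.map PadicInt.Coe.ringHom).formalExp.subst (C ((c' : ℚ) : ℚ_[3]) * L₃) with htdef
  have hDt : D₃ = ((V.map PadicInt.Coe.ringHom).formalMul 3).subst t :=
    eq_formalMul_subst_formalExp_of_formalLog_subst' (V.map PadicInt.Coe.ringHom) 3 hD₃0 hL₃0 hcc' hlog2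
  have hu0 : constantCoeff (C ((c' : ℚ) : ℚ_[3]) * L₃) = 0 := by rw [map_mul, hL₃0, mul_zero]
  have ht0 : constantCoeff t = 0 := by
    rw [htdef, Literature.RingTheory.FormalGroups.constantCoeff_subst_of_constantCoeff_eq_zero hu0,
      constantCoeff_formalExp]
  have hL₃int : IsPadicInt L₃ := by
    rw [isPadicInt_iff_coeff]
    intro n
    rw [hL₃, hι, coeff_map, lSeriesLog, coeff_mk, hrat]
    by_cases hn0 : n = 0
    · subst hn0; simp
    by_cases h3n : 3 ∣ n
    · rw [han n, lFunction_eq_zero_of_three_dvd W ha3 hN3 hn0 h3n]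
      simp
    · push_cast
      rw [div_eq_mul_inv, norm_mul, padic_norm_inv_natCast_of_not_dvd h3n, mul_one]
      exact Padic.norm_int_le_one _
  have hc'int : IsPadicInt (C ((c' : ℚ) : ℚ_[3]) : ℚ_[3]⟦X⟧) := by
    rw [Rat.cast_intCast]
    exact IsPadicInt.powerSeries_C (Padic.norm_int_le_one _)
  have htint : IsPadicInt t :=
    hexpint.powerSeries_subst (hc'int.mul hL₃int) (HasSubst.of_constantCoeff_zero' hu0)
  -- `t ≠ 0`, `D₃ ≠ 0`
  have hL₃1 : coeff 1 L₃ = 1 := by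
    rw [hL₃, hι, coeff_map, lSeriesLog, coeff_mk, hrat, han 1, W.isMultiplicative_LFunction.map_one]
    simp
  have hD₃ne : D₃ ≠ 0 := by
    intro h0
    have hsub0 : (V.map PadicInt.Coe.ringHom).formalLog.subst (0 : ℚ_[3]⟦X⟧) = 0 := by
      rw [subst_zero_eq_C_constantCoeff, constantCoeff_formalLog, map_zero, map_zero]
    have h := hlog2
    rw [h0, hsub0] at h
    have h1 := congrArg (coeff 1) h
    rw [map_zero, coeff_C_mul, hL₃1, mul_one] at h1
    exact hc0 (by exact_mod_cast h1.symm)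
  have hDne : ((V.map PadicInt.Coe.ringHom).formalMul 3).subst t ≠ 0 := hDt ▸ hD₃ne
  have htne : t ≠ 0 := fun h0 => hDne <| by
    rw [h0, subst_zero_eq_C_constantCoeff, constantCoeff_formalMul, map_zero, map_zero]
  -- §D the `3`-torsion point `T♮ = (X₀/c², Y₀/c³)` on `E♮ ⊗ ℚ₃`
  have hcQ : (D.c : ℚ) ≠ 0 := Int.cast_ne_zero.mpr hc0
  have heqc : Y₀ ^ 2 = X₀ ^ 3 + (shortModel W D.c).a₄ * X₀ + (shortModel W D.c).a₆ := by
    have h := (Affine.equation_iff X₀ Y₀).mp hns.1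
    simp only [shortModel] at h ⊢
    linear_combination h
  have ha₄c : (shortModel W D.c).a₄ = (D.c : ℚ) ^ 4 * (shortModel W 1).a₄ := by
    simp only [shortModel, Int.cast_one, one_pow, one_mul]; ring
  have ha₆c : (shortModel W D.c).a₆ = (D.c : ℚ) ^ 6 * (shortModel W 1).a₆ := by
    simp only [shortModel, Int.cast_one, one_pow, one_mul]; ring
  have heq1 : (Y₀ / (D.c : ℚ) ^ 3) ^ 2 =
      (X₀ / (D.c : ℚ) ^ 2) ^ 3 + (shortModel W 1).a₄ * (X₀ / (D.c : ℚ) ^ 2) + (shortModel W 1).a₆ := by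
    rw [ha₄c, ha₆c] at heqc
    field_simp
    linear_combination heqc
  set X₁ : ℚ_[3] := ((X₀ / (D.c : ℚ) ^ 2 : ℚ) : ℚ_[3]) with hX₁
  set Y₁ : ℚ_[3] := ((Y₀ / (D.c : ℚ) ^ 3 : ℚ) : ℚ_[3]) with hY₁
  have heqE : (V.map PadicInt.Coe.ringHom).toAffine.Equation X₁ Y₁ := by
    rw [Affine.equation_iff, hEa₁, hEa₂, hEa₃, hEa₄, hEa₆, hX₁, hY₁]
    have h := congrArg (fun q : ℚ => (q : ℚ_[3])) heq1
    push_cast at h ⊢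
    linear_combination h
  have hT₁ : (V.map PadicInt.Coe.ringHom).toAffine.Nonsingular X₁ Y₁ := (Affine.equation_iff_nonsingular).mp heqE
  -- `Ψ₃(T♮) = 0`
  have hΨc : 3 * X₀ ^ 4 + 6 * (shortModel W D.c).a₄ * X₀ ^ 2 + 12 * (shortModel W D.c).a₆ * X₀
      - (shortModel W D.c).a₄ ^ 2 = 0 := by
    have h := hΨ
    rw [Polynomial.IsRoot, WeierstrassCurve.Ψ₃] at h
    simp only [WeierstrassCurve.b₂, WeierstrassCurve.b₄, WeierstrassCurve.b₆, WeierstrassCurve.b₈, Polynomial.eval_add,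
      Polynomial.eval_mul, Polynomial.eval_pow, Polynomial.eval_C, Polynomial.eval_X,
      Polynomial.eval_ofNat] at h
    have h1 : (shortModel W D.c).a₁ = 0 := rfl
    have h2 : (shortModel W D.c).a₂ = 0 := rfl
    have h3 : (shortModel W D.c).a₃ = 0 := rfl
    rw [h1, h2, h3] at h
    linear_combination h
  have hΨ1 : 3 * (X₀ / (D.c : ℚ) ^ 2) ^ 4 + 6 * (shortModel W 1).a₄ * (X₀ / (D.c : ℚ) ^ 2) ^ 2
      + 12 * (shortModel W 1).a₆ * (X₀ / (D.c : ℚ) ^ 2) - (shortModel W 1).a₄ ^ 2 = 0 := by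
    rw [ha₄c, ha₆c] at hΨc
    field_simp
    linear_combination hΨc
  have hψ3 : ((V.map PadicInt.Coe.ringHom).ψ 3).evalEval X₁ Y₁ = 0 := by
    rw [WeierstrassCurve.ψ_three, Polynomial.evalEval_C, WeierstrassCurve.Ψ₃]
    simp only [WeierstrassCurve.b₂, WeierstrassCurve.b₄, WeierstrassCurve.b₆, WeierstrassCurve.b₈, Polynomial.eval_add,
      Polynomial.eval_mul, Polynomial.eval_pow, Polynomial.eval_C, Polynomial.eval_X,
      Polynomial.eval_ofNat, hEa₁, hEa₂, hEa₃, hEa₄, hEa₆, hX₁]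
    have h := congrArg (fun q : ℚ => (q : ℚ_[3])) hΨ1
    push_cast at h ⊢
    linear_combination h
  have h3T₁ : 3 • Affine.Point.some X₁ Y₁ hT₁ = 0 := by
    rw [← natCast_zsmul]
    exact (Affine.Point.zsmul_some_eq_zero_iff hT₁ 3).mpr hψ3
  -- §E the tripling identity on `E♮`
  obtain ⟨A₁, B₁, hBne, key⟩ := kummerTripling_padic V hT₁ h3T₁ ht0 htne htint hDne
  rw [← hDt] at key
  -- §F `Y₀ ≠ 0` (else `T` would be `2`- and `3`-torsion) and the tangent slope `λ = α/c`
  have hY₀ : Y₀ ≠ 0 := by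
    intro hY
    have h2 : (2 : ℤ) • Affine.Point.some X₀ Y₀ hns = 0 := by
      refine (Affine.Point.zsmul_some_eq_zero_iff hns 2).mpr ?_
      rw [WeierstrassCurve.ψ_two, WeierstrassCurve.ψ₂, Affine.evalEval_polynomialY, hY]
      simp [shortModel]
    have h3 : (3 : ℤ) • Affine.Point.some X₀ Y₀ hns = 0 := by
      refine (Affine.Point.zsmul_some_eq_zero_iff hns 3).mpr ?_
      rw [WeierstrassCurve.ψ_three, Polynomial.evalEval_C]; exact hΨ
    have h1 : Affine.Point.some X₀ Y₀ hns =
        (3 : ℤ) • Affine.Point.some X₀ Y₀ hns - (2 : ℤ) • Affine.Point.some X₀ Y₀ hns := by abel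
    rw [h2, h3, sub_zero] at h1
    exact Affine.Point.some_ne_zero _ h1
  have hY₁0 : Y₁ ≠ 0 := by
    rw [hY₁]; push_cast
    exact div_ne_zero (by exact_mod_cast hY₀) (pow_ne_zero 3 (by exact_mod_cast hcQ))
  have hlam : (V.map PadicInt.Coe.ringHom).toAffine.slope X₁ X₁ Y₁ Y₁ =
      ((tangentSlope W D.c X₀ Y₀ : ℚ) : ℚ_[3]) / ((D.c : ℚ) : ℚ_[3]) := by
    have hneg : Y₁ ≠ (V.map PadicInt.Coe.ringHom).toAffine.negY X₁ Y₁ := by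
      rw [Affine.negY, hEa₁, hEa₃]; intro h
      apply hY₁0; linear_combination (1 / 2 : ℚ_[3]) * h
    have hden : Y₁ - (V.map PadicInt.Coe.ringHom).toAffine.negY X₁ Y₁ = 2 * Y₁ := by
      rw [Affine.negY, hEa₁, hEa₃]; ring
    rw [Affine.slope_of_Y_ne rfl hneg, hden, hEa₁, hEa₂, hEa₄, tangentSlope, ha₄c, hX₁, hY₁]
    have hc3 : ((D.c : ℚ) : ℚ_[3]) ≠ 0 := by exact_mod_cast hcQ
    have hY3 : ((Y₀ : ℚ) : ℚ_[3]) ≠ 0 := by exact_mod_cast hY₀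
    push_cast
    field_simp
    ring
  -- §G `Θ_T` read on `E♮ ⊗ ℚ₃` is the series of `kummerTripling_padic`
  have hzs : HasSubst z := HasSubst.of_constantCoeff_zero' hz0
  have hXc : ι ((shortModel W D.c).formalXMulSq.subst z) =
      (V.map PadicInt.Coe.ringHom).formalXMulSq.subst D₃ := by
    rw [formalXMulSq_shortModel_subst W hc0 hz0, hι,
      map_subst_apply (HasSubst.of_constantCoeff_zero' hcz0), map_formalXMulSq, ← hVE, map_mul, map_C, hrat]
  have hYc : ι ((shortModel W D.c).formalYMulCube.subst z) =
      -(V.map PadicInt.Coe.ringHom).formalXMulSq.subst D₃ := by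
    have hY : (shortModel W D.c).formalYMulCube = -(shortModel W D.c).formalXMulSq := rfl
    rw [hY, ← coe_substAlgHom hzs, map_neg, coe_substAlgHom hzs, map_neg, hXc]
  have hc3 : ((D.c : ℚ) : ℚ_[3]) ≠ 0 := by exact_mod_cast hcQ
  have hΘ : (kummerCubeSeries W D.c X₀ Y₀ z).map (algebraMap ℚ ℚ_[3]) =
      -(V.map PadicInt.Coe.ringHom).formalXMulSq.subst D₃ - C Y₁ * D₃ ^ 3
        - C ((V.map PadicInt.Coe.ringHom).toAffine.slope X₁ X₁ Y₁ Y₁) *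
          ((V.map PadicInt.Coe.ringHom).formalXMulSq.subst D₃ * D₃ - C X₁ * D₃ ^ 3) := by
    change ι (kummerCubeSeries W D.c X₀ Y₀ z) = _
    rw [kummerCubeSeries, smul_eq_C_mul, smul_eq_C_mul, smul_eq_C_mul, map_sub, map_sub, map_mul, map_mul, map_sub,
      map_mul, map_mul, map_pow, hYc, hXc, hlam]
    simp only [hι, map_C, hrat, hD₃, hX₁, hY₁]
    set XD := (V.map PadicInt.Coe.ringHom).formalXMulSq.subst (C ((D.c : ℚ) : ℚ_[3]) * PowerSeries.map (algebraMap ℚ ℚ_[3]) z)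
    set zz := PowerSeries.map (algebraMap ℚ ℚ_[3]) z
    have e1 : (C (((Y₀ / (D.c : ℚ) ^ 3 : ℚ) : ℚ_[3])) : ℚ_[3]⟦X⟧) * C ((D.c : ℚ) : ℚ_[3]) ^ 3 = C ((Y₀ : ℚ) : ℚ_[3]) := by
      rw [← map_pow, ← map_mul]; congr 1; push_cast; field_simp
    have e2 : (C ((((tangentSlope W D.c X₀ Y₀ : ℚ) : ℚ_[3])) / ((D.c : ℚ) : ℚ_[3])) : ℚ_[3]⟦X⟧) * C ((D.c : ℚ) : ℚ_[3])
        = C ((tangentSlope W D.c X₀ Y₀ : ℚ) : ℚ_[3]) := by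
      rw [← map_mul]; congr 1; field_simp
    have e3 : (C ((((tangentSlope W D.c X₀ Y₀ : ℚ) : ℚ_[3])) / ((D.c : ℚ) : ℚ_[3])) : ℚ_[3]⟦X⟧) *
        C (((X₀ / (D.c : ℚ) ^ 2 : ℚ) : ℚ_[3])) * C ((D.c : ℚ) : ℚ_[3]) ^ 3 =
        C ((tangentSlope W D.c X₀ Y₀ : ℚ) : ℚ_[3]) * C ((X₀ : ℚ) : ℚ_[3]) := by
      rw [← map_pow, ← map_mul, ← map_mul, ← map_mul]; congr 1; push_cast; field_simp
    linear_combination (zz ^ 3) * e1 + (XD * zz) * e2 - (zz ^ 3) * e3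
  -- §H assemble
  refine ⟨A₁, B₁, hBne, ?_⟩
  rw [Subsingleton.elim (Rat.castHom ℚ_[3]) (algebraMap ℚ ℚ_[3]), hΘ]
  exact key

/-- **Corollary: the `p = 3` certificate E-an-58 is unconditional.**  `ManinPrimeToThreeOfEtaExponent` (if a
rational point of order `3` of an `X₀(N)`-parametrised `W`, `9 ∣ N`, has a cuspidal Kummer cube representative
with an `η`-exponent not divisible by `3`, then `3 ∤ c`) — from `ManinThreeKummerCube_holds` and p2's reduction
`maninPrimeToThreeOfEtaExponent_of_maninThreeKummerCube` (E-an-56 + UFD step).  `c`-free inputs (E-an-57, an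
exponent `≢ 0 (mod 3)`) remain open; nothing about any actual Manin constant is asserted. [folklore] -/
theorem ManinPrimeToThreeOfEtaExponent_holds : ManinPrimeToThreeOfEtaExponent :=
  maninPrimeToThreeOfEtaExponent_of_maninThreeKummerCube ManinThreeKummerCube_holds

end Summit.BirchSwinnertonDyer.BirchSwinnertonDyer.Theorems.ManinLocalTwoThree

namespace Summit.BirchSwinnertonDyer.BirchSwinnertonDyer.Theorems

open Summit.BirchSwinnertonDyer.Rank1Residual.ManinAdditive.CuspidalKummerThree in
/-- **Stub 3 of line `kato_shift_three` v7 (crux C3 `ManinPrimeToThreeAtNine`, stmt-BirchSwinnertonDyer-22968) BY NAME**: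
`stub_maninThreeKummerCube : ManinThreeKummerCube` is E-an-55, i.e. `ManinLocalTwoThree.ManinThreeKummerCube_holds` above
(skeleton of record `Cruxes/ManinPrimeToThreeAtNine/Lines/kato_shift_three.lean`, registered 2026-08-28T09:52Z; remaining stubs
F-es-18, E-an-57, LAW₃, RES₃′).  Nothing about BSD or Manin's conjecture is proved here. [cite: Honda1970, Thm. 2 (p. 223)] -/
theorem stub_maninThreeKummerCube : ManinThreeKummerCube := ManinLocalTwoThree.ManinThreeKummerCube_holds

end Summit.BirchSwinnertonDyer.BirchSwinnertonDyer.Theorems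

end
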